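import Summits.QuantumAdvantage.AdviceFreeQNC0.RegisterChainEval
import Summits.QuantumAdvantage.AdviceFreeQNC0.TwistBoundX3LocalQuant
import HarnessLib

/-!
# Cell qa-qnc0, `p = 3` — twisted walk sums of EVALUATED strategies: core bound, main bound, the two packaged theorems

Continuation of `RegisterChainEval.lean`.  For a walk strategy `Y` (u-frame, ANY charge `c`) admitting correct register-chain
evaluators of radius `r` (`MidSpec`, `FinSpec`), the twisted win sum

  `S(γ) = Σ_u e₃(Σ_i [x(u)_i] γ_i) · [WIN_c(Y)(u)]`

obeys the block-decay bounds of the `r`-local theory (qn-prover-3 g22, `TwistBoundX3LocalProof` / `TwistBoundX3LocalQuant`), by the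
same path-sum argument (`sum_pathW_eq`, `rnsq_chainFrom_le_pow`, block lemma `blockOpR_contracts` / `rnsq_blockOpR_le_quant`):

* `core_boundE`, `main_boundU` — `‖S(γ)‖ ≤ 9·8^r·ρ^{cnt}·2ⁿ` (`4r + 3 ≤ n`, `cnt` the greedy block count of `γ`);
* **`twistBoundU_of_eval`** — `∀ r, ∃ A, ρ < 1: ‖S(γ)‖ ≤ A·ρ^{#supp γ}·2ⁿ` for every `n, c` and every evaluated `Y`;
* **`twistBoundUQ_of_eval`** — the radius-uniform form `‖S(γ)‖ ≤ 9e^{1/32}·64^r·exp(−(#supp γ − 4r)/(32(2r+1)³))·2ⁿ`.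

Instances (`TwistBoundStateLocal.lean`): walk-window-local bells, also when they read the hidden walk state `st u g`.
WHAT THIS IS NOT: no new analytic input; crux 22907 untouched; no separation.
-/

noncomputable section

namespace Summit.QuantumAdvantage.AdviceFreeQNC0

open Finset Literature.Computability.MetaComplexity Literature.Computability.QuantumComplexity

namespace BondTwist3

open TransferWalk ConstBells TwistedTransfer

variable {n r : ℕ}

/-! ## The core bound -/

/-- **CORE BOUND** for an evaluated strategy: the `τ`-resolved twisted sign sum is `≤ 4^r·(3·2^r)·ρ^{cnt}·2ⁿ`. -/
theorem core_boundE {ρ : ℝ} (hρ0 : 0 ≤ ρ)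
    (hblock : ∀ (ζ₀ : ℂ), ζ₀ ^ 3 = 1 → ζ₀ ≠ 1 → ∀ (ω : Fin (2 * r) → ℂ), (∀ j, ω j ^ 3 = 1) →
      ∀ (ε' : Fin (2 * r + 1) → RegState r → Bool → Bool) (g : RegState r → ℂ),
        rnsq (blockOpR ζ₀ ω ε' g) ≤ ρ ^ 2 * rnsq g)
    {Y : Fin (n + 1) → (Fin n → Bool) → Bool} {em : ℕ → RegState r → Bool → Bool}
    {ef : (Fin (2 * r) → Bool) → RegState r → ℕ → Bool} (hem : MidSpec Y em) (hf : FinSpec Y ef)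
    (γ : Fin (n + 1) → ZMod 3) (κ τ : ZMod 3) (hn : 4 * r + 3 ≤ n) :
    ‖∑ u : Fin n → Bool, (ZMod.stdAddChar (∑ i : Fin (n + 1), if xOfU u i then γ i else 0) : ℂ) *
        ((if st u n = τ then (1 : ℂ) else 0) * ∏ g : Fin (n + 1), sgnF (Y g u) κ (st u g.val) τ)‖ ≤
      (4 : ℝ) ^ r * (3 * (2 : ℝ) ^ r) * ρ ^ (cnt (bsOf r n γ) (2 * r + 1) 0 n) * (2 : ℝ) ^ n := by
  classical
  set c := cnt (bsOf r n γ) (2 * r + 1) 0 n with hc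
  have hsum : ∑ u : Fin n → Bool, (ZMod.stdAddChar (∑ i : Fin (n + 1), if xOfU u i then γ i else 0) : ℂ) *
        ((if st u n = τ then (1 : ℂ) else 0) * ∏ g : Fin (n + 1), sgnF (Y g u) κ (st u g.val) τ) =
      ∑ a : Fin (2 * r) → Bool, (2 : ℂ) ^ n * chainFrom (WaE γ em κ τ a) (fFinE γ ef κ τ a) 0 n (initState r) := by
    rw [Finset.sum_congr rfl fun u _ => pointwise_eqE hem hf γ κ τ hn u, Finset.sum_comm]
    refine Finset.sum_congr rfl fun a _ => ?_
    have e1 : ∀ u : Fin n → Bool, pathW (WaE γ em κ τ a) (fFinE γ ef κ τ a) 0 (initState r) n (xs u) =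
        pathW (WaE γ em κ τ a) (fFinE γ ef κ τ a) 0 (initState r) n (extB (letters u)) :=
      fun u => pathW_congr _ _ 0 (initState r) n fun m hm => (extB_letters u hm).symm
    rw [Finset.sum_congr rfl fun u _ => e1 u,
      sum_letters (fun b => pathW (WaE γ em κ τ a) (fFinE γ ef κ τ a) 0 (initState r) n (extB b)), sum_pathW_eq]
  rw [hsum]
  have hterm : ∀ a : Fin (2 * r) → Bool,
      ‖(2 : ℂ) ^ n * chainFrom (WaE γ em κ τ a) (fFinE γ ef κ τ a) 0 n (initState r)‖ ≤
        (2 : ℝ) ^ n * (ρ ^ c * (3 * (2 : ℝ) ^ r)) := by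
    intro a
    rw [norm_mul, norm_pow, Complex.norm_two]
    refine mul_le_mul_of_nonneg_left ?_ (by positivity)
    have h1 := norm_sq_le_rnsq (chainFrom (WaE γ em κ τ a) (fFinE γ ef κ τ a) 0 n) (initState r)
    have h2 := rnsq_chainFrom_le_pow hblock (WaE γ em κ τ a) (fun j => phase γ j) (fun j => epsE em κ τ j)
      (fun j => decide (2 * r ≤ j)) (bsOf r n γ) (norm_WaE_le γ em κ τ a) (phase_cube γ)
      (fun j hj => WaE_eq_signW γ em κ τ a (of_decide_eq_true hj)) (bsOf_spec γ) (fFinE γ ef κ τ a) n 0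
    have h3 : rnsq (fFinE γ ef κ τ a) ≤ 6 * (4 : ℝ) ^ r := by
      have := rnsq_le_card (fFinE γ ef κ τ a) (norm_fFinE_le γ ef κ τ a)
      rw [card_regState] at this; exact_mod_cast this
    have h4 : ‖chainFrom (WaE γ em κ τ a) (fFinE γ ef κ τ a) 0 n (initState r)‖ ^ 2 ≤ (ρ ^ c * (3 * (2 : ℝ) ^ r)) ^ 2 := by
      have e : (ρ ^ c * (3 * (2 : ℝ) ^ r)) ^ 2 = (ρ ^ 2) ^ c * (9 * (4 : ℝ) ^ r) := by
        have h4 : (4 : ℝ) ^ r = ((2 : ℝ) ^ r) ^ 2 := by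
          rw [show (4 : ℝ) = 2 ^ 2 by norm_num, ← pow_mul, ← pow_mul, mul_comm]
        have hρ2 : (ρ ^ 2) ^ c = (ρ ^ c) ^ 2 := by rw [← pow_mul, ← pow_mul, mul_comm]
        rw [h4, hρ2]; ring
      rw [e]
      rw [← hc] at h2
      have hρc : 0 ≤ (ρ ^ 2) ^ c := by positivity
      calc ‖chainFrom (WaE γ em κ τ a) (fFinE γ ef κ τ a) 0 n (initState r)‖ ^ 2
          ≤ (ρ ^ 2) ^ c * rnsq (fFinE γ ef κ τ a) := h1.trans h2
        _ ≤ (ρ ^ 2) ^ c * (6 * (4 : ℝ) ^ r) := mul_le_mul_of_nonneg_left h3 hρc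
        _ ≤ (ρ ^ 2) ^ c * (9 * (4 : ℝ) ^ r) := by gcongr; norm_num
    have := abs_le_of_sq_le_sq h4 (by positivity)
    rwa [abs_norm] at this
  calc ‖∑ a : Fin (2 * r) → Bool, (2 : ℂ) ^ n * chainFrom (WaE γ em κ τ a) (fFinE γ ef κ τ a) 0 n (initState r)‖
      ≤ ∑ a : Fin (2 * r) → Bool, ‖(2 : ℂ) ^ n * chainFrom (WaE γ em κ τ a) (fFinE γ ef κ τ a) 0 n (initState r)‖ :=
        norm_sum_le _ _
    _ ≤ ∑ _a : Fin (2 * r) → Bool, (2 : ℝ) ^ n * (ρ ^ c * (3 * (2 : ℝ) ^ r)) := sum_le_sum fun a _ => hterm a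
    _ = (4 : ℝ) ^ r * (3 * (2 : ℝ) ^ r) * ρ ^ c * (2 : ℝ) ^ n := by
        rw [sum_const, card_univ, Fintype.card_fun, Fintype.card_bool, Fintype.card_fin, nsmul_eq_mul]
        push_cast
        rw [pow_mul]; ring

/-- The `τ`-resolved weight of the EMPTY strategy: `Σ_τ [st u n = τ]·Π 1 = 1`. -/
theorem sum_resolve_emptyU (κ : ZMod 3) (u : Fin n → Bool) :
    ∑ τ : ZMod 3, (if st u n = τ then (1 : ℂ) else 0) *
        ∏ g : Fin (n + 1), sgnF ((fun (_ : Fin (n + 1)) (_ : Fin n → Bool) => false) g u) κ (st u g.val) τ = 1 := by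
  have h1 : ∀ τ : ZMod 3, (∏ g : Fin (n + 1),
      sgnF ((fun (_ : Fin (n + 1)) (_ : Fin n → Bool) => false) g u) κ (st u g.val) τ) = 1 :=
    fun τ => prod_eq_one fun g _ => by unfold sgnF; simp
  simp_rw [h1, mul_one]
  rw [Finset.sum_ite_eq univ (st u n) (fun _ => (1 : ℂ)), if_pos (mem_univ _)]

/-- The trivial bound in walk coordinates: the twisted win sum has norm `≤ 2ⁿ`. -/
theorem trivial_boundU (c : ℕ) (Y : Fin (n + 1) → (Fin n → Bool) → Bool) (γ : Fin (n + 1) → ZMod 3) :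
    ‖∑ u : Fin n → Bool, (ZMod.stdAddChar (∑ i : Fin (n + 1), if xOfU u i then γ i else 0) : ℂ) *
        (if ringWinU c Y u = true then (1 : ℂ) else 0)‖ ≤ (2 : ℝ) ^ n := by
  classical
  refine (norm_sum_le _ _).trans ?_
  have hterm : ∀ u : Fin n → Bool, ‖(ZMod.stdAddChar (∑ i : Fin (n + 1), if xOfU u i then γ i else 0) : ℂ) *
      (if ringWinU c Y u = true then (1 : ℂ) else 0)‖ ≤ 1 := by
    intro u
    rw [norm_mul]
    have h1 : ‖(ZMod.stdAddChar (∑ i : Fin (n + 1), if xOfU u i then γ i else 0) : ℂ)‖ ≤ 1 := by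
      have h3 := stdAddChar_cube (∑ i : Fin (n + 1), if xOfU u i then γ i else 0)
      have hn : ‖(ZMod.stdAddChar (∑ i : Fin (n + 1), if xOfU u i then γ i else 0) : ℂ)‖ ^ 3 = 1 := by
        rw [← norm_pow, h3, norm_one]
      exact ((pow_eq_one_iff_of_nonneg (norm_nonneg _) (by norm_num)).1 hn).le
    have h2 : ‖(if ringWinU c Y u = true then (1 : ℂ) else 0)‖ ≤ 1 := by split_ifs <;> simp
    exact mul_le_one₀ h1 (norm_nonneg _) h2
  refine (sum_le_sum fun u _ => hterm u).trans ?_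
  rw [sum_const, card_univ, Fintype.card_fun, Fintype.card_bool, Fintype.card_fin]
  simp

/-! ## The main bound (walk coordinates, every charge) -/

/-- **MAIN BOUND** for an evaluated strategy (`4r + 3 ≤ n`, any charge `c`, any block constant `ρ ≥ 0` satisfying the block
lemma): `‖Σ_u e₃(γ·x(u))·[WIN_c(Y)(u)]‖ ≤ 9·8^r·ρ^{cnt}·2ⁿ`. -/
theorem main_boundU {ρ : ℝ} (hρ0 : 0 ≤ ρ)
    (hblock : ∀ (ζ₀ : ℂ), ζ₀ ^ 3 = 1 → ζ₀ ≠ 1 → ∀ (ω : Fin (2 * r) → ℂ), (∀ j, ω j ^ 3 = 1) →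
      ∀ (ε' : Fin (2 * r + 1) → RegState r → Bool → Bool) (g : RegState r → ℂ),
        rnsq (blockOpR ζ₀ ω ε' g) ≤ ρ ^ 2 * rnsq g)
    {Y : Fin (n + 1) → (Fin n → Bool) → Bool} {em : ℕ → RegState r → Bool → Bool}
    {ef : (Fin (2 * r) → Bool) → RegState r → ℕ → Bool} (hem : MidSpec Y em) (hf : FinSpec Y ef)
    (c : ℕ) (γ : Fin (n + 1) → ZMod 3) (hn : 4 * r + 3 ≤ n) :
    ‖∑ u : Fin n → Bool, (ZMod.stdAddChar (∑ i : Fin (n + 1), if xOfU u i then γ i else 0) : ℂ) *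
        (if ringWinU c Y u = true then (1 : ℂ) else 0)‖ ≤
      9 * 8 ^ r * ρ ^ (cnt (bsOf r n γ) (2 * r + 1) 0 n) * (2 : ℝ) ^ n := by
  classical
  set Y0 : Fin (n + 1) → (Fin n → Bool) → Bool := fun _ _ => false with hY0
  set E : (Fin n → Bool) → ℂ := fun u => (ZMod.stdAddChar (∑ i : Fin (n + 1), if xOfU u i then γ i else 0) : ℂ) with hE
  set κ : ZMod 3 := ((c + 2 * n : ℕ) : ZMod 3) with hκ
  set C1 : ZMod 3 → ℂ := fun τ => ∑ u : Fin n → Bool, E u *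
    ((if st u n = τ then (1 : ℂ) else 0) * ∏ g : Fin (n + 1), sgnF (Y0 g u) κ (st u g.val) τ) with hC1
  set C2 : ZMod 3 → ℂ := fun τ => ∑ u : Fin n → Bool, E u *
    ((if st u n = τ then (1 : ℂ) else 0) * ∏ g : Fin (n + 1), sgnF (Y g u) κ (st u g.val) τ) with hC2
  have hGsplit : ∀ u : Fin n → Bool, E u * (if ringWinU c Y u = true then (1 : ℂ) else 0) =
      (E u * (∑ τ : ZMod 3, (if st u n = τ then (1 : ℂ) else 0) * ∏ g : Fin (n + 1), sgnF (Y0 g u) κ (st u g.val) τ) -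
       E u * (∑ τ : ZMod 3, (if st u n = τ then (1 : ℂ) else 0) * ∏ g : Fin (n + 1), sgnF (Y g u) κ (st u g.val) τ)) / 2 := by
    intro u
    have hsign := winSign_eq_sum c Y u
    have hsg : ∀ (τ : ZMod 3) (g : Fin (n + 1)),
        (if (Y g u = true ∧ ((c + 2 * n : ℕ) : ZMod 3) + st u g.val + τ ≠ 0) then (-1 : ℂ) else 1) =
          sgnF (Y g u) κ (st u g.val) τ := fun τ g => rfl
    simp only [hsg] at hsign
    rw [sum_resolve_emptyU κ u, ← hsign]
    split_ifs <;> ring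
  have hGsum : ∑ u : Fin n → Bool, E u * (if ringWinU c Y u = true then (1 : ℂ) else 0) =
      ((∑ τ : ZMod 3, C1 τ) - ∑ τ : ZMod 3, C2 τ) / 2 := by
    simp_rw [hGsplit]
    rw [← Finset.sum_div, Finset.sum_sub_distrib]
    congr 2
    · simp only [hC1]; rw [Finset.sum_comm]; exact sum_congr rfl fun u _ => by rw [Finset.mul_sum]
    · simp only [hC2]; rw [Finset.sum_comm]; exact sum_congr rfl fun u _ => by rw [Finset.mul_sum]
  rw [hGsum, norm_div, Complex.norm_two]
  set M : ℝ := (4 : ℝ) ^ r * (3 * (2 : ℝ) ^ r) * ρ ^ (cnt (bsOf r n γ) (2 * r + 1) 0 n) * (2 : ℝ) ^ n with hM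
  have hB1 : ∀ τ, ‖C1 τ‖ ≤ M := fun τ => core_boundE hρ0 hblock midSpec_empty finSpec_empty γ κ τ hn
  have hB2 : ∀ τ, ‖C2 τ‖ ≤ M := fun τ => core_boundE hρ0 hblock hem hf γ κ τ hn
  have h3 : ∀ C : ZMod 3 → ℂ, (∀ τ, ‖C τ‖ ≤ M) → ‖∑ τ : ZMod 3, C τ‖ ≤ 3 * M := by
    intro C hC
    calc ‖∑ τ : ZMod 3, C τ‖ ≤ ∑ τ : ZMod 3, ‖C τ‖ := norm_sum_le _ _
      _ ≤ ∑ _τ : ZMod 3, M := sum_le_sum fun τ _ => hC τ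
      _ = 3 * M := by rw [sum_const, card_univ, ZMod.card]; simp
  have htri := norm_sub_le (∑ τ : ZMod 3, C1 τ) (∑ τ : ZMod 3, C2 τ)
  have hS : ‖(∑ τ : ZMod 3, C1 τ) - ∑ τ : ZMod 3, C2 τ‖ / 2 ≤ 3 * M := by
    have := h3 C1 hB1; have := h3 C2 hB2
    have hM0 : 0 ≤ M := by rw [hM]; positivity
    linarith
  refine hS.trans (le_of_eq ?_)
  rw [hM, show (8 : ℝ) = 4 * 2 by norm_num, mul_pow]
  ring

/-! ## The packaged theorems -/

/-- **Twisted walk sums of evaluated strategies decay in `#supp γ`** (radius `r` fixed): `∃ A, ρ < 1` such that for every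
`n`, every charge and every `Y` with correct evaluators of radius `r`, `‖S(γ)‖ ≤ A·ρ^{#supp γ}·2ⁿ`. -/
theorem twistBoundU_of_eval (r : ℕ) : ∃ A ρ : ℝ, 0 ≤ A ∧ 0 ≤ ρ ∧ ρ < 1 ∧
    ∀ (n c : ℕ) (Y : Fin (n + 1) → (Fin n → Bool) → Bool),
      (∃ (em : ℕ → RegState r → Bool → Bool) (ef : (Fin (2 * r) → Bool) → RegState r → ℕ → Bool),
        MidSpec Y em ∧ FinSpec Y ef) →
      ∀ γ : Fin (n + 1) → ZMod 3,
        ‖∑ u : Fin n → Bool, (ZMod.stdAddChar (∑ i : Fin (n + 1), if xOfU u i then γ i else 0) : ℂ) *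
            (if ringWinU c Y u = true then (1 : ℂ) else 0)‖
          ≤ A * ρ ^ (univ.filter fun i : Fin (n + 1) => γ i ≠ 0).card * (2 : ℝ) ^ n := by
  classical
  obtain ⟨ρ, hρ0, hρ1, hblock⟩ := blockOpR_contracts r
  set ρ' : ℝ := max (1 - (1 - ρ) / (2 * r + 1)) (1 / 2) with hρ'
  have hR : (0 : ℝ) < 2 * r + 1 := by positivity
  have hδ : 0 < (1 - ρ) / (2 * r + 1) := div_pos (by linarith) hR
  have hδ1 : (1 - ρ) / (2 * r + 1) ≤ 1 := by
    rw [div_le_one hR]; have : (0 : ℝ) ≤ 2 * r := by positivity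
    linarith
  have hρ'1 : ρ' < 1 := max_lt (by linarith) (by norm_num)
  have hρ'pos : 0 < ρ' := lt_of_lt_of_le (by norm_num) (le_max_right _ _)
  have hρρ' : ρ ≤ ρ' ^ (2 * r + 1) := by
    have hb := one_add_mul_le_pow (show (-2 : ℝ) ≤ -((1 - ρ) / (2 * r + 1)) by linarith) (2 * r + 1)
    have e : (1 : ℝ) + ((2 * r + 1 : ℕ) : ℝ) * -((1 - ρ) / (2 * r + 1)) = ρ := by
      push_cast; field_simp; ring
    rw [e] at hb
    refine hb.trans (pow_le_pow_left₀ (by linarith) ?_ _)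
    rw [← sub_eq_add_neg]; exact le_max_left _ _
  have hinv1 : 1 ≤ ρ'⁻¹ := (one_le_inv₀ hρ'pos).2 hρ'1.le
  refine ⟨9 * 8 ^ r * (ρ'⁻¹) ^ (4 * r + 3), ρ', by positivity, hρ'pos.le, hρ'1, fun n c Y hev γ => ?_⟩
  obtain ⟨em, ef, hem, hf⟩ := hev
  set w := (univ.filter fun i : Fin (n + 1) => γ i ≠ 0).card with hw
  have hwN : w ≤ n + 1 := (card_filter_le _ _).trans (by simp)
  have hrate : ρ' ^ (w - (4 * r + 1)) ≤ (ρ'⁻¹) ^ (4 * r + 3) * ρ' ^ w := by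
    have h1 : ρ' ^ (w - (4 * r + 1) + (4 * r + 3)) ≤ ρ' ^ w := pow_le_pow_of_le_one hρ'pos.le hρ'1.le (by omega)
    have h2 : ρ' ^ (w - (4 * r + 1)) = ρ' ^ (w - (4 * r + 1) + (4 * r + 3)) * (ρ'⁻¹) ^ (4 * r + 3) := by
      rw [pow_add, mul_assoc, ← mul_pow, mul_inv_cancel₀ hρ'pos.ne', one_pow, mul_one]
    rw [h2, mul_comm]
    exact mul_le_mul_of_nonneg_left h1 (by positivity)
  by_cases hn : n < 4 * r + 3
  · refine (trivial_boundU c Y γ).trans ?_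
    have h1 : (1 : ℝ) ≤ (ρ'⁻¹) ^ (4 * r + 3) * ρ' ^ w := by
      have e : (ρ'⁻¹) ^ (4 * r + 3) * ρ' ^ w = (ρ'⁻¹) ^ (4 * r + 3 - w) := by
        rw [show 4 * r + 3 = (4 * r + 3 - w) + w by omega, pow_add, Nat.add_sub_cancel, mul_assoc, ← mul_pow,
          inv_mul_cancel₀ hρ'pos.ne', one_pow, mul_one]
      rw [e]; exact one_le_pow₀ hinv1
    have h2 : (1 : ℝ) ≤ 9 * 8 ^ r := by
      have : (1 : ℝ) ≤ 8 ^ r := one_le_pow₀ (by norm_num)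
      linarith
    have h2N : (0 : ℝ) < (2 : ℝ) ^ n := by positivity
    calc (2 : ℝ) ^ n = 1 * 1 * (2 : ℝ) ^ n := by ring
      _ ≤ (9 * 8 ^ r) * ((ρ'⁻¹) ^ (4 * r + 3) * ρ' ^ w) * (2 : ℝ) ^ n := by gcongr
      _ = 9 * 8 ^ r * (ρ'⁻¹) ^ (4 * r + 3) * ρ' ^ w * (2 : ℝ) ^ n := by ring
  have hn' : 4 * r + 3 ≤ n := by omega
  refine (main_boundU hρ0 hblock hem hf c γ hn').trans ?_
  have hcnt : w - (4 * r + 1) ≤ (2 * r + 1) * cnt (bsOf r n γ) (2 * r + 1) 0 n := by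
    have h1 := card_starts_le (bsOf r n γ) (show 0 < 2 * r + 1 by omega) n 0
    have h2 := card_supp_le (r := r) γ
    omega
  have hρc : ρ ^ (cnt (bsOf r n γ) (2 * r + 1) 0 n) ≤ (ρ'⁻¹) ^ (4 * r + 3) * ρ' ^ w := by
    calc ρ ^ (cnt (bsOf r n γ) (2 * r + 1) 0 n)
        ≤ (ρ' ^ (2 * r + 1)) ^ (cnt (bsOf r n γ) (2 * r + 1) 0 n) := pow_le_pow_left₀ hρ0 hρρ' _
      _ = ρ' ^ ((2 * r + 1) * cnt (bsOf r n γ) (2 * r + 1) 0 n) := by rw [pow_mul]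
      _ ≤ ρ' ^ (w - (4 * r + 1)) := pow_le_pow_of_le_one hρ'pos.le hρ'1.le hcnt
      _ ≤ (ρ'⁻¹) ^ (4 * r + 3) * ρ' ^ w := hrate
  have hK : (0 : ℝ) ≤ 9 * 8 ^ r := by positivity
  calc 9 * 8 ^ r * ρ ^ (cnt (bsOf r n γ) (2 * r + 1) 0 n) * (2 : ℝ) ^ n
      ≤ (9 * 8 ^ r) * ((ρ'⁻¹) ^ (4 * r + 3) * ρ' ^ w) * (2 : ℝ) ^ n := by gcongr
    _ = 9 * 8 ^ r * (ρ'⁻¹) ^ (4 * r + 3) * ρ' ^ w * (2 : ℝ) ^ n := by ring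

/-- **Radius-uniform form** (`A = 9e^{1/32}`, rate `exp(−(#supp γ − 4r)/(32(2r+1)³))`): for every `r, n, c` and every `Y` with
correct evaluators of radius `r`. -/
theorem twistBoundUQ_of_eval :
    ∀ (r n c : ℕ) (Y : Fin (n + 1) → (Fin n → Bool) → Bool),
      (∃ (em : ℕ → RegState r → Bool → Bool) (ef : (Fin (2 * r) → Bool) → RegState r → ℕ → Bool),
        MidSpec Y em ∧ FinSpec Y ef) →
      ∀ γ : Fin (n + 1) → ZMod 3,
        ‖∑ u : Fin n → Bool, (ZMod.stdAddChar (∑ i : Fin (n + 1), if xOfU u i then γ i else 0) : ℂ) *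
            (if ringWinU c Y u = true then (1 : ℂ) else 0)‖
          ≤ 9 * Real.exp (1 / 32) * (64 : ℝ) ^ r *
              Real.exp (-(1 / 32 * (((univ.filter fun i : Fin (n + 1) => γ i ≠ 0).card : ℝ) - 4 * r) /
                (2 * (r : ℝ) + 1) ^ 3)) * (2 : ℝ) ^ n := by
  classical
  intro r n c Y hev γ
  obtain ⟨em, ef, hem, hf⟩ := hev
  set ρ : ℝ := Real.exp (-(1 / (16 * (2 * (r : ℝ) + 1)) / 2)) with hρ
  have hρ0 : 0 ≤ ρ := (Real.exp_pos _).le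
  have hblock := blockOpR_le_exp r
  have hR1 : (1 : ℝ) ≤ 2 * (r : ℝ) + 1 := by have : (0 : ℝ) ≤ r := Nat.cast_nonneg r; linarith
  set w := (univ.filter fun i : Fin (n + 1) => γ i ≠ 0).card with hw
  have hwN : w ≤ n + 1 := (card_filter_le _ _).trans (by simp)
  have h64 : (1 : ℝ) ≤ 64 ^ r := one_le_pow₀ (by norm_num)
  by_cases hN : n < 4 * r + 3
  · refine (trivial_boundU c Y γ).trans ?_
    have hY1 : Real.exp (-(4 / 32)) ≤ Real.exp (-(1 / 32 * ((w : ℝ) - 4 * r) / (2 * (r : ℝ) + 1) ^ 3)) := by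
      apply Real.exp_le_exp.2
      have hnum : 1 / 32 * ((w : ℝ) - 4 * r) ≤ 4 / 32 := by
        have : (w : ℝ) ≤ 4 * r + 4 := by
          have : w ≤ 4 * r + 4 := by omega
          exact_mod_cast this
        linarith
      have hR3 : (1 : ℝ) ≤ (2 * (r : ℝ) + 1) ^ 3 := one_le_pow₀ hR1
      by_cases hs : 0 ≤ 1 / 32 * ((w : ℝ) - 4 * r)
      · have : 1 / 32 * ((w : ℝ) - 4 * r) / (2 * (r : ℝ) + 1) ^ 3 ≤ 1 / 32 * ((w : ℝ) - 4 * r) :=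
          div_le_self hs hR3
        linarith
      · have : 1 / 32 * ((w : ℝ) - 4 * r) / (2 * (r : ℝ) + 1) ^ 3 ≤ 0 :=
          div_nonpos_of_nonpos_of_nonneg (le_of_lt (not_le.1 hs)) (by positivity)
        linarith
    have hE : (1 : ℝ) ≤ 9 * Real.exp (1 / 32) * Real.exp (-(4 / 32)) := by
      rw [mul_assoc, ← Real.exp_add]
      have h := Real.add_one_le_exp (1 / 32 + -(4 / 32) : ℝ)
      nlinarith
    have h2N : (0 : ℝ) < (2 : ℝ) ^ n := by positivity
    calc (2 : ℝ) ^ n = 1 * 1 * (2 : ℝ) ^ n := by ring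
      _ ≤ (9 * Real.exp (1 / 32) * Real.exp (-(4 / 32))) * 64 ^ r * (2 : ℝ) ^ n := by gcongr
      _ ≤ (9 * Real.exp (1 / 32) * Real.exp (-(1 / 32 * ((w : ℝ) - 4 * r) / (2 * (r : ℝ) + 1) ^ 3))) *
            64 ^ r * (2 : ℝ) ^ n := by gcongr
      _ = 9 * Real.exp (1 / 32) * 64 ^ r *
            Real.exp (-(1 / 32 * ((w : ℝ) - 4 * r) / (2 * (r : ℝ) + 1) ^ 3)) * (2 : ℝ) ^ n := by ring
  have hn : 4 * r + 3 ≤ n := by omega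
  refine (main_boundU hρ0 hblock hem hf c γ hn).trans ?_
  set cb := cnt (bsOf r n γ) (2 * r + 1) 0 n with hc
  have hcnt : w - (4 * r + 1) ≤ (2 * r + 1) * cb := by
    have h1 := card_starts_le (bsOf r n γ) (show 0 < 2 * r + 1 by omega) n 0
    rw [← hc] at h1
    have h2 := card_supp_le (r := r) γ
    omega
  have hc' : ((w : ℝ) - 4 * r) - 1 ≤ (2 * (r : ℝ) + 1) * cb := by
    by_cases hle : 4 * r + 1 ≤ w
    · have : (((w - (4 * r + 1) : ℕ)) : ℝ) ≤ (((2 * r + 1) * cb : ℕ) : ℝ) := by exact_mod_cast hcnt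
      rw [Nat.cast_sub hle] at this
      push_cast at this
      linarith
    · have h0 : (0 : ℝ) ≤ (2 * (r : ℝ) + 1) * cb := by positivity
      have : (w : ℝ) < 4 * r + 1 := by exact_mod_cast (not_le.1 hle)
      linarith
  have hρc : ρ ^ cb ≤ Real.exp (1 / 32) * Real.exp (-(1 / 32 * ((w : ℝ) - 4 * r) / (2 * (r : ℝ) + 1) ^ 3)) := by
    rw [hρ, ← Real.exp_nat_mul, ← Real.exp_add]
    apply Real.exp_le_exp.2
    have e : (cb : ℝ) * -(1 / (16 * (2 * (r : ℝ) + 1)) / 2) = -(1 / (16 * (2 * (r : ℝ) + 1)) / 2 * cb) := by ring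
    rw [e]
    exact rate_ineq (2 * (r : ℝ) + 1) ((w : ℝ) - 4 * r) cb hR1 (Nat.cast_nonneg cb) hc'
  have h8 : (8 : ℝ) ^ r ≤ 64 ^ r := pow_le_pow_left₀ (by norm_num) (by norm_num) r
  calc 9 * 8 ^ r * ρ ^ cb * (2 : ℝ) ^ n
      ≤ 9 * 64 ^ r * (Real.exp (1 / 32) * Real.exp (-(1 / 32 * ((w : ℝ) - 4 * r) / (2 * (r : ℝ) + 1) ^ 3))) *
          (2 : ℝ) ^ n := by gcongr
    _ = 9 * Real.exp (1 / 32) * 64 ^ r *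
          Real.exp (-(1 / 32 * ((w : ℝ) - 4 * r) / (2 * (r : ℝ) + 1) ^ 3)) * (2 : ℝ) ^ n := by ring

end BondTwist3

end Summit.QuantumAdvantage.AdviceFreeQNC0

end
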